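import Literature.MathematicalPhysics.QuantumFieldTheory.Balaban1983to89.Node00.TorusCoverLandau153RecTowerDoorGrad

/-!
# EXPLICIT-`u` EDITION (dag-n07-e g32, URGENT-2 2026-08-30 03:05Z) of dag-n07-w3 g13's ✓p757755 `Node00.TorusCoverLandau153RecTowerDoorGradPrecomp` — TOKEN TWIN: the member
# gauge is a BINDER (`u` in STAGE 1, `um` in STAGE 2) instead of the existential `∃ u` inside `hG` ∕ `∃ um` in the exported tuple; statements and proofs otherwise byte-identical
# (text by dag-n07-w3; the edit: binder added, `∃ u …,`∕`∃ um …,` deleted, one `obtain` slot and one tuple slot fewer).  WHY: the junction's knit feeds `um := h⁻¹·u₀` (the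
# pre-composed crown's output) and its row 9′ needs that NAME back in the door formula `ι(u(π(x+c_k𝟙))) = (um x)⁻¹·vfix V x` — an `∃`-edition forgets it and cannot be upgraded
# by a corollary.  Consumed by dag-n07-e's MODULE 129 `Summits/…/BalabanUVNodesN07Thm4Rows152OfDatumCrownPhiAt` via the STAGE 3 twin `…RecDatumDoorGradPrecompExplicit`.
#
# NODE 00 — THE R7 DOOR, STAGES 1–2, **PRE-COMPOSED EDITION**: `exists_suGauge_letters152_recTower_member_grad` (g12) and `exists_localGauge152_recTower_window_member_grad` (g12)
# VERBATIM with the TWO pass-through conjuncts `Restr129Z L k Λ′ 1 u` and the (1.137) row `logCovIterZ … = mlog (avgIterZ (c.axial V) …)` DELETED from the input `hG` and from the exported tuple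

Cell `pub-ymgap`, width seat `pub-ymgap-dag-n07-w3` g13 (junction side of the K0 road; (W2) door re-cut (P-a), located by dag-n07-e g32 ⚑ LOCATED-W2-DOOR, bus 2026-08-30 02:23Z).
`--kind proof --supports stmt-QuantumFields-20541` (K0⁷; count-neutral; THEOREMS ONLY, 0 `def`).  [6] = [Balaban1985RegularSpaces]; [15] = [Balaban1985Variational]; [I] = [Balaban1987RG1].
CONSUMED BY NAME, nothing modified: g10's `Node00.TorusCoverLandau153RecTower` (`exists_suGauge_of_specialUnitaryGauge_local`, `sideTouches_of_mem_fam`, `CubeB8DZ.mem_sq_zero_iff_inBox ∕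
cube_top_subset_sq_pred ∕ sq_zero_subset_tcube`), `Node00.TorusCoverLandau153RecTowerDoor` (`cover_shift_add_e ∕ _sub_e`, `codiffCurlA_coverShift_eq_pdiv_of_window`,
`lap_coverShift_eq_covLap_of_window`, `cfgExp_eq_expI`), `Node00.TorusCoverPropSixGaugeLevels.norm_logCfg_sub_le_of_msup_grad_at`, g11's `B8Eq191FlatLettersDentedCubeMemberRec.sq_antitone`.

WHY.  The three generic R7 doors of this lineage (STAGE 1 ✓`…RecTowerGrad`, STAGE 2 ✓`…RecTowerDoorGrad`, STAGE 3 ✓`…RecDatumDoorGrad` §1) take ONE gauge function `u` in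
`hG := ∃ u, SU ∧ (u = 1 off Ω′₀) ∧ Restr129Z … u ∧ IsLandau138WZ … (fixed V u) ∧ rows(fixed V u, expo η V u, (vfix V)⁻¹·u, …)` and RE-EXPORT `Restr129Z … u` (and likewise the (1.137) row `logCovIterZ … = mlog (avgIterZ (c.axial V) …)`) without ever reading them in a
proof step (they served the OLD rows 9 ∕ 9′).  The junction's φ-road feeds the doors with the PRE-COMPOSED crown's gauge function `u := h⁻¹·u₀` (`h` block-constant on the cell towers, dag-n05-e
✓`B8BlockConstantLiftDentedRec`; this seat's ✓p751907 `DatumCrownPhiAt` delivers `Restr129Z … u₀` and the rows at `h⁻¹·u₀`), for which `Restr129Z … (h⁻¹·u₀)` is FALSE whenever `h ≠ 1`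
(`R̄ʲ(h⁻¹u₀)(y) = X(j,y)⁻¹`, ✓p752835) and whose (1.137) row reads `… = mlog (avgIterZ (gaugeAct h (c.axial V)) …)` (pre-composed), not the doors' shape.  THIS FILE is the token-deletion twin:
statements and proofs byte-identical to g12's except that the two conjuncts are absent from `hG`, from the output, from one `obtain` pattern and one anonymous-constructor entry per stage
(located by dag-n07-e g32, bus 02:23Z ∕ 02:50Z).  The new row 9′ (`NrmSymPhiOfRecord … (Ψ ε j)`) is supplied by the junction from `u₀` and `h` directly.

WHAT IS PROVED (sorry-free).  ★★ `exists_suGauge_letters152_recTower_member_grad_precomp_explicit` (STAGE 1, generic `CubeB8DZ d L K Ω`, generic `SU(N)`-valued `ℤᵈ` field `V`) and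
★★ `exists_localGauge152_recTower_window_member_grad_precomp_explicit` (STAGE 2, the window push-down through a translated cover) — g12's statements minus the two conjuncts, proofs verbatim.
HONEST FRAMING: count-neutral helper; a TOKEN-DELETION twin of landed helper files (no landed theorem is wrong: the deleted conjunct is TRUE where the originals are used, it is
merely unavailable for the junction's precomposed gauge function); nothing of [6]∕[15]∕[I] asserted or discharged; `DatumCrownPhiAt` ∕ `HThm4RecSym152PhiE(G)` ∕ `HThm4Rec*`
DISPLAYED∕CONDITIONAL; N05 ∕ N07 NOT discharged; K0⁷ ∕ K1⁹ NOT closed; counts unmoved (typed 28∕28 · discharged 8∕28); one finite 𝕋⁴ programme at fixed ε — R4 closes the conditional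
finite-𝕋⁴ rung `BalabanLadder.UV` only; the YM mass gap (Clay) is NOT proved by any of this; nothing continuum ∕ ℝ⁴ ∕ OS.  No `def`, no `instance`, no `notation`, no `sorry`.

References: [15] (144)–(153) pp. 300–301, (152) p. 301; [6] Prop. 6 (1.135)–(1.138) p. 99, (1.29) p. 81, (1.131) p. 99; [3] = [Balaban1985Averaging] (78)–(81) p. 30; [I] (0.3)–(0.4) pp. 252–253.
-/

noncomputable section

namespace Literature.MathematicalPhysics.QuantumFieldTheory.Balaban1983to89.Node00

open scoped Matrix.Norms.L2Operator
open B7Prop1Explicit (e e_apply gaugeAct)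
open B7Prop1Local (InBox AgreeOn)
open B7Prop2Explicit (unitaryUnits mem_unitaryUnits)
open B7Prop2SpecialUnitary (specialUnitaryUnits mem_specialUnitaryUnits)
open BlockAveragingZd (avgIterZ ctrShift)
open B8Ineq132 (covDerivFwd covDeriv BondTouches)
open B8Eq131Cubes (tLo tHi ctr gs)
open B8Eq131CubesRec (boxZ cubeZ tcubeZ bLoZ bHiZ)
open B8Eq140Level (SideTouches sideTouches_of_bondTouches)
open B8Eq138LandauZd (logCfg covDivB covLap)
open B8Eq138LandauZdRec (IsLandau138Z IsLandau138WZ)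
open B7SectEFLinearisationRec (logCovIterZ)
open B8Eq184Proof (cfgExp)
open B8LeafModelZd3 (mlogCfg)
open B8ScaledSupNorm (msup Bdd bondNorm)
open B8Eq146AExpansion (plaqCovDeriv iEta)
open B8Eq143PlaqExpansion (pdiv)
open MatrixLog (mlog)
open Complex (I)
open B8Eq140Level (SideTouches)
open B15Eq112TorusCover (cover)
open B14DomainGeom (Pt)
open B12RegularSpaces111 (gaugeU expI grad)

section Stage1PrecompExplicit

variable {d N : ℕ} [NeZero N] {L K : ℕ} {Ω : ℕ → Set (B7Prop1Explicit.Site d)}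

/-- ★★ **STAGE 1 OF THE R7 DOOR, PRE-COMPOSED EDITION** — `exists_suGauge_letters152_recTower_member_grad` (g12) with the pass-through conjuncts `Restr129Z L c.k c.lamS 1 u` and (1.137) `logCovIterZ … = mlog (avgIterZ L (c.axial V) …)` deleted
from `hG` and from the exported tuple; everything else (the `SU(N)` normalisation on `□₀`, the (152) letters at every level, the Landau row, the member identity `ιSU s = u_m⁻¹·vfix`, the
all-levels gradient letter and the `(−2)` row) VERBATIM, proof verbatim.
[cite: Balaban1985Variational, (152) p.301, (144)–(153) pp.300–301; Balaban1985RegularSpaces, Prop. 6 (1.135)–(1.136) p.99, (1.29) p.81, (1.131) p.99, p.77; Balaban1985Averaging, (78)–(81) p.30; Balaban1987RG1, (0.3)–(0.4) pp.252–253]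
EXPLICIT-`u` EDITION: the member gauge `u` is a binder and the exported rows name it (no `∃ u` in `hG`, no `∃ um`). -/
theorem exists_suGauge_letters152_recTower_member_grad_precomp_explicit (hd : 2 ≤ d) (hLo : Odd L) (hL : 2 ≤ L) (c : CubeB8DZ d L K Ω)
    (V : B7Prop1Explicit.Site d → Fin d → (MatA N)ˣ) (hV : ∀ x μ, V x μ ∈ specialUnitaryUnits (Fin N)) {η r : ℝ} (hη : 0 < η) (hr : 0 ≤ r)
    (u : B7Prop1Explicit.Site d → (MatA N)ˣ) (hG : letI : CStarAlgebra (MatA N) := {};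
      (∀ x, u x ∈ specialUnitaryUnits (Fin N)) ∧ (∀ x, x ∉ c.sq 0 → u x = 1) ∧
        IsLandau138WZ L c.k η (c.sq 0) c.lamS (1 : B7Prop1Explicit.Site d → Fin d → (MatA N)ˣ) (c.fixed V u) ∧
        (∀ j, j ≤ c.k → ∀ b ∈ {b : B7Prop1Explicit.Site d × Fin d | SideTouches (c.sq j) b.1 b.2},
          c.fixed V u b.1 b.2 = cfgExp η (logCfg η (c.fixed V u)) b.1 b.2 ∧ IsSelfAdjoint (logCfg η (c.fixed V u) b.1 b.2) ∧
            ‖logCfg η (c.fixed V u) b.1 b.2‖ ≤ r * ((L : ℝ) ^ j * η)⁻¹) ∧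
        (∀ x, ((c.vfix V)⁻¹ * u) x ∈ specialUnitaryUnits (Fin N)) ∧
        AgreeOn (B8Ineq130Rec.tlo L (tLo c.a c.ρ) c.k) (B8Ineq130Rec.thi L (tHi c.a c.M c.ρ) c.k) (gaugeAct ((c.vfix V)⁻¹ * u)⁻¹ V) (c.fixed V u) ∧
        msup L c.k η (-(2 : ℝ)) (fun j (t : Fin d × Fin d × B7Prop1Explicit.Site d) => SideTouches (c.sq j) t.2.2 t.2.1)
            (fun t => covDerivFwd η (1 : B7Prop1Explicit.Site d → Fin d → (MatA N)ˣ) t.1 (fun z => c.expo η V u z t.2.1) t.2.2) ≤ r ∧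
        bondNorm L c.k η (-(3 : ℝ)) c.sq
            (fun x μ => pdiv η (1 : B7Prop1Explicit.Site d → Fin d → (MatA N)ˣ) (plaqCovDeriv η (1 : B7Prop1Explicit.Site d → Fin d → (MatA N)ˣ) (c.expo η V u)) μ x) ≤ r ∧
        bondNorm L c.k η (-(3 : ℝ)) c.sq (fun x μ => covLap η (1 : B7Prop1Explicit.Site d → Fin d → (MatA N)ˣ) (fun z => c.expo η V u z μ) x) ≤ r)
    (hsmall : 4 * ((N : ℝ) * r) < 2 * Real.pi) :
    letI : CStarAlgebra (MatA N) := {}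
    ∃ s : B7Prop1Explicit.Site d → Matrix.specialUnitaryGroup (Fin N) ℂ,
      (∀ x μ, x ∈ c.sq 0 → x + e μ ∈ c.sq 0 →
          gaugeAct (fun y => ιSU N (s y)) V x μ = cfgExp η (logCfg η (c.fixed V u)) x μ) ∧
      (∀ j, j ≤ c.k → ∀ x μ, x ∈ c.sq j → x + e μ ∈ c.sq j → ‖logCfg η (c.fixed V u) x μ‖ ≤ 2 * (r * ((L : ℝ) ^ j * η)⁻¹)) ∧
      (∀ x μ, x ∈ cubeZ L c.a c.M c.ρ c.k c.k → x + e μ ∈ cubeZ L c.a c.M c.ρ c.k c.k →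
          ‖logCfg η (c.fixed V u) x μ‖ ≤ 2 * (r * ((L : ℝ) ^ (c.k - 1) * η)⁻¹)) ∧
      (∀ x μ ν, x ∈ cubeZ L c.a c.M c.ρ c.k c.k → x + e μ ∈ cubeZ L c.a c.M c.ρ c.k c.k → x + e ν ∈ cubeZ L c.a c.M c.ρ c.k c.k →
          ‖logCfg η (c.fixed V u) (x + e μ) ν - logCfg η (c.fixed V u) x ν‖ ≤ 2 * (η * r * (((L : ℝ) ^ (c.k - 1) * η) ^ 2)⁻¹)) ∧
      (∀ x μ, x ∈ cubeZ L c.a c.M c.ρ c.k c.k → x + e μ ∈ cubeZ L c.a c.M c.ρ c.k c.k →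
          (∀ ν, x + e ν ∈ cubeZ L c.a c.M c.ρ c.k c.k ∧ x - e ν ∈ cubeZ L c.a c.M c.ρ c.k c.k ∧ x - e ν + e μ ∈ cubeZ L c.a c.M c.ρ c.k c.k) →
          ‖pdiv η (1 : B7Prop1Explicit.Site d → Fin d → (MatA N)ˣ) (plaqCovDeriv η 1 (logCfg η (c.fixed V u))) μ x‖ ≤
            2 * (r * (((L : ℝ) ^ (c.k - 1) * η) ^ 3)⁻¹)) ∧
      (∀ x μ, x ∈ cubeZ L c.a c.M c.ρ c.k c.k → x + e μ ∈ cubeZ L c.a c.M c.ρ c.k c.k →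
          (∀ ν, x + e ν ∈ cubeZ L c.a c.M c.ρ c.k c.k ∧ x - e ν ∈ cubeZ L c.a c.M c.ρ c.k c.k) →
          ‖covLap η (1 : B7Prop1Explicit.Site d → Fin d → (MatA N)ˣ) (fun z => logCfg η (c.fixed V u) z μ) x‖ ≤ 2 * (r * (((L : ℝ) ^ (c.k - 1) * η) ^ 3)⁻¹)) ∧
      IsLandau138Z L c.k η (c.sq 0) c.lamS (1 : B7Prop1Explicit.Site d → Fin d → (MatA N)ˣ) (logCfg η (c.fixed V u)) ∧
      (∀ x, x ∈ c.sq 0 → ιSU N (s x) = (u x)⁻¹ * c.vfix V x) ∧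
      (∀ x, u x ∈ specialUnitaryUnits (Fin N)) ∧ (∀ x, x ∉ c.sq 0 → u x = 1) ∧
      -- ★ NEW (T2b input): (152) member 2 read at EVERY level of the dented tower, for the EXPORTED member gauge `u`
      (∀ j, j ≤ c.k → ∀ x μ ν, x ∈ c.sq j → x + e μ ∈ c.sq j →
          ‖logCfg η (c.fixed V u) (x + e μ) ν - logCfg η (c.fixed V u) x ν‖ ≤ 2 * (η * r * (((L : ℝ) ^ j * η) ^ 2)⁻¹)) ∧
      -- ★ NEW (pass-through): the crown's `|∇^η A|_(−2) ≤ r` row itself, for `u`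
      msup L c.k η (-(2 : ℝ)) (fun j (t : Fin d × Fin d × B7Prop1Explicit.Site d) => SideTouches (c.sq j) t.2.2 t.2.1)
          (fun t => covDerivFwd η (1 : B7Prop1Explicit.Site d → Fin d → (MatA N)ˣ) t.1 (fun z => c.expo η V u z t.2.1) t.2.2) ≤ r := by
  letI : CStarAlgebra (MatA N) := {}
  have hL1 : 1 ≤ L := le_trans (by norm_num) hL
  have hk1 : c.k - 1 ≤ c.k := Nat.sub_le _ _
  obtain ⟨hu, hoff, h138, h162, hw, h135, h136₂, h136₃, h136₄⟩ := hG
  set w : B7Prop1Explicit.Site d → (MatA N)ˣ := (c.vfix V)⁻¹ * u with hwdef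
  set U₁ : B7Prop1Explicit.Site d → Fin d → (MatA N)ˣ := c.fixed V u with hU₁
  have h138' : IsLandau138Z L c.k η (c.sq 0) c.lamS (1 : B7Prop1Explicit.Site d → Fin d → (MatA N)ˣ) (logCfg η U₁) := h138
  have h136' : ∀ j, j ≤ c.k → ∀ b ∈ {b : B7Prop1Explicit.Site d × Fin d | SideTouches (c.sq j) b.1 b.2},
      ‖logCfg η U₁ b.1 b.2‖ ≤ r * ((L : ℝ) ^ j * η)⁻¹ := fun j hj b hb => (h162 j hj b hb).2.2
  -- `□₀` as a centred `InBox`, inside `□̃`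
  set lo₀ : B7Prop1Explicit.Site d := bLoZ L c.a c.k (c.ρ * gs L c.k) with hlo₀
  set hi₀ : B7Prop1Explicit.Site d := bHiZ L c.a c.M c.k (c.ρ * gs L c.k) with hhi₀
  have hsq : ∀ x, InBox lo₀ hi₀ x ↔ x ∈ c.sq 0 := fun x => (CubeB8DZ.mem_sq_zero_iff_inBox hLo c x).symm
  have hsqT : c.sq 0 ⊆ tcubeZ L c.a c.M c.ρ c.k := CubeB8DZ.sq_zero_subset_tcube hLo hL c
  -- the data of the SU normalisation on the box `□₀`: `w⁻¹` is `SU(N)`-valued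
  have hg : ∀ x, InBox lo₀ hi₀ x → w⁻¹ x ∈ specialUnitaryUnits (Fin N) := fun x _ => by
    rw [Pi.inv_apply]; exact (specialUnitaryUnits (Fin N)).inv_mem (hw x)
  have hgauge : ∀ x μ, InBox lo₀ hi₀ x → InBox lo₀ hi₀ (x + e μ) → gaugeAct w⁻¹ V x μ = cfgExp η (logCfg η U₁) x μ := by
    intro x μ hx hx'
    have hx0 := (hsq x).1 hx
    rw [h135 x μ (hsqT hx0) (hsqT ((hsq _).1 hx'))]
    exact (h162 0 (Nat.zero_le _) (x, μ) (sideTouches_of_mem_fam hd hx0 μ)).1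
  have hsa : ∀ x μ, InBox lo₀ hi₀ x → InBox lo₀ hi₀ (x + e μ) → IsSelfAdjoint (logCfg η U₁ x μ) := fun x μ hx _ =>
    (h162 0 (Nat.zero_le _) (x, μ) (sideTouches_of_mem_fam hd ((hsq x).1 hx) μ)).2.1
  have hA : ∀ x μ, InBox lo₀ hi₀ x → InBox lo₀ hi₀ (x + e μ) → η * (N * ‖logCfg η U₁ x μ‖) ≤ N * r := by
    intro x μ hx _
    have h := h136' 0 (Nat.zero_le _) (x, μ) (sideTouches_of_mem_fam hd ((hsq x).1 hx) μ)
    simp only [pow_zero, one_mul] at h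
    have hN : (0 : ℝ) ≤ N := Nat.cast_nonneg N
    calc η * (N * ‖logCfg η U₁ x μ‖) ≤ η * (N * (r * η⁻¹)) := mul_le_mul_of_nonneg_left (mul_le_mul_of_nonneg_left h hN) hη.le
      _ = N * r := by field_simp
  have hVdet : ∀ x μ, InBox lo₀ hi₀ x → InBox lo₀ hi₀ (x + e μ) → ((V x μ : (MatA N)ˣ) : MatA N).det = 1 := fun x μ _ _ =>
    (Matrix.mem_specialUnitaryGroup_iff.1 (hV x μ)).2
  obtain ⟨s, hs, -, hsg⟩ := exists_suGauge_of_specialUnitaryGauge_local lo₀ hi₀ hη V w⁻¹ (logCfg η U₁) hVdet hg hgauge hsa hA hsmall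
  -- the pure top cube `□_k` lies in `Ω′_{k−1}`: every bond based in it is a side touching the tower (the window of the unmasked readings)
  have htop : cubeZ L c.a c.M c.ρ c.k c.k ⊆ c.sq (c.k - 1) := CubeB8DZ.cube_top_subset_sq_pred hLo c
  have hW : ∀ y ∈ cubeZ L c.a c.M c.ρ c.k c.k, ∀ τ : Fin d, ∃ j, j ≤ c.k ∧ SideTouches (c.sq j) y τ :=
    fun y hy τ => ⟨c.k - 1, hk1, sideTouches_of_mem_fam hd (htop hy) τ⟩
  -- weakening `t ≤ 2t` for the nonnegative letters
  have h2 : ∀ {a t : ℝ}, 0 ≤ t → a ≤ t → a ≤ 2 * t := fun ht h => h.trans (by linarith)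
  have hLη : ∀ j : ℕ, 0 ≤ r * ((L : ℝ) ^ j * η)⁻¹ := fun j => by positivity
  refine ⟨s, fun x μ hx hx' => hsg x μ ((hsq x).2 hx) ((hsq _).2 hx'), fun j hj x μ hx _ => ?_, fun x μ hx _ => ?_, fun x μ ν hx hx' _ => ?_,
    fun x μ hx hx' hν => ?_, fun x μ hx _ hν => ?_, h138', fun x hx => ?_, hu, hoff, fun j hj x μ ν hx hx' => ?_, h136₂⟩
  · exact h2 (hLη j) (h136' j hj (x, μ) (sideTouches_of_mem_fam hd hx μ))
  · exact h2 (hLη (c.k - 1)) (h136' (c.k - 1) hk1 (x, μ) (sideTouches_of_mem_fam hd (htop hx) μ))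
  · exact h2 (by positivity) (norm_logCfg_sub_le_of_msup_grad_at c.sq c.k hL1 hη hr U₁ h136' h136₂ hW hk1 hx hx'
      (sideTouches_of_mem_fam hd (htop hx) ν))
  · exact h2 (by positivity) (norm_codiff_logCfg_le_at c.sq c.k hL1 hη hr U₁ h136' h136₃ hW hk1 hx hx' hν (Or.inl (htop hx)))
  · exact h2 (by positivity) (norm_lap_logCfg_le_at c.sq c.k hL1 hη hr U₁ h136' h136₄ hW hk1 hx (fun ν => ⟨(hν ν).1, (hν ν).2⟩) (Or.inl (htop hx)))
  · rw [hs x ((hsq x).2 hx), hwdef]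
    simp only [Pi.inv_apply, Pi.mul_apply, mul_inv_rev, inv_inv]
  · -- the new all-levels gradient letter: window `W := Ω′₀` (every site of `Ω′₀` is a side of a plaquette touching `Ω′₀`), level `j`
    have hW0 : ∀ y ∈ c.sq 0, ∀ τ : Fin d, ∃ j', j' ≤ c.k ∧ SideTouches (c.sq j') y τ :=
      fun y hy τ => ⟨0, Nat.zero_le _, sideTouches_of_mem_fam hd hy τ⟩
    have hsub : c.sq j ⊆ c.sq 0 := B8Eq191FlatLettersDentedCubeMemberRec.sq_antitone c hLo (Nat.zero_le j)
    exact h2 (by positivity) (norm_logCfg_sub_le_of_msup_grad_at c.sq c.k hL1 hη hr U₁ h136' h136₂ hW0 hj (hsub hx) (hsub hx')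
      (sideTouches_of_mem_fam hd hx ν))

end Stage1PrecompExplicit

section Stage2PrecompExplicit

variable {P : Params} {N : ℕ} [NeZero N]

/-- ★★ **STAGE 2 OF THE R7 DOOR, PRE-COMPOSED EDITION** — `exists_localGauge152_recTower_window_member_grad` (g12: the window push-down through the translated cover
`x ↦ π(x + t)`, injective on the large window `X′`) with the pass-through conjuncts `Restr129Z P.L c.k c.lamS 1 u` and (1.137) `logCovIterZ … = mlog (avgIterZ P.L (c.axial V) …)` deleted from `hG` and from the exported tuple;
proof verbatim over STAGE 1's pre-composed edition.
[cite: Balaban1985Variational, (144)–(153) pp.300–301; Balaban1985RegularSpaces, Prop. 6 (1.135)–(1.138) p.99, (1.29) p.81, (1.131) p.99; Balaban1985Averaging, (78)–(81) p.30; Balaban1987RG1, (0.3)–(0.4) pp.252–253]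
EXPLICIT-`u` EDITION: the member gauge `um` is a binder and the exported rows name it (no `∃ u` in `hG`, no `∃ um`). -/
theorem exists_localGauge152_recTower_window_member_grad_precomp_explicit (hd : 2 ≤ P.d) {K' : ℕ} {Ω' : ℕ → Set (B7Prop1Explicit.Site P.d)} (c : CubeB8DZ P.d P.L K' Ω')
    (U : GaugeField P 0 (SU N)) (t : Pt P.d) {n : ℕ} (hk : c.k = n) {r : ℝ} (hr : 0 ≤ r)
    (um : B7Prop1Explicit.Site P.d → (MatA N)ˣ) (hG : letI : CStarAlgebra (MatA N) := {};
      (∀ x, um x ∈ specialUnitaryUnits (Fin N)) ∧ (∀ x, x ∉ c.sq 0 → um x = 1) ∧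
        IsLandau138WZ P.L c.k (P.eta n) (c.sq 0) c.lamS (1 : B7Prop1Explicit.Site P.d → Fin P.d → (MatA N)ˣ)
          (c.fixed (fun x μ => ιSU N (U ⟨cover P (x + t), μ⟩)) um) ∧
        (∀ j, j ≤ c.k → ∀ b ∈ {b : B7Prop1Explicit.Site P.d × Fin P.d | SideTouches (c.sq j) b.1 b.2},
          c.fixed (fun x μ => ιSU N (U ⟨cover P (x + t), μ⟩)) um b.1 b.2 =
              cfgExp (P.eta n) (logCfg (P.eta n) (c.fixed (fun x μ => ιSU N (U ⟨cover P (x + t), μ⟩)) um)) b.1 b.2 ∧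
            IsSelfAdjoint (logCfg (P.eta n) (c.fixed (fun x μ => ιSU N (U ⟨cover P (x + t), μ⟩)) um) b.1 b.2) ∧
            ‖logCfg (P.eta n) (c.fixed (fun x μ => ιSU N (U ⟨cover P (x + t), μ⟩)) um) b.1 b.2‖ ≤ r * ((P.L : ℝ) ^ j * P.eta n)⁻¹) ∧
        (∀ x, ((c.vfix (fun x μ => ιSU N (U ⟨cover P (x + t), μ⟩)))⁻¹ * um) x ∈ specialUnitaryUnits (Fin N)) ∧
        AgreeOn (B8Ineq130Rec.tlo P.L (tLo c.a c.ρ) c.k) (B8Ineq130Rec.thi P.L (tHi c.a c.M c.ρ) c.k)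
          (gaugeAct ((c.vfix (fun x μ => ιSU N (U ⟨cover P (x + t), μ⟩)))⁻¹ * um)⁻¹ (fun x μ => ιSU N (U ⟨cover P (x + t), μ⟩)))
          (c.fixed (fun x μ => ιSU N (U ⟨cover P (x + t), μ⟩)) um) ∧
        msup P.L c.k (P.eta n) (-(2 : ℝ)) (fun j (q : Fin P.d × Fin P.d × B7Prop1Explicit.Site P.d) => SideTouches (c.sq j) q.2.2 q.2.1)
            (fun q => covDerivFwd (P.eta n) (1 : B7Prop1Explicit.Site P.d → Fin P.d → (MatA N)ˣ) q.1
              (fun z => c.expo (P.eta n) (fun x μ => ιSU N (U ⟨cover P (x + t), μ⟩)) um z q.2.1) q.2.2) ≤ r ∧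
        bondNorm P.L c.k (P.eta n) (-(3 : ℝ)) c.sq
            (fun x μ => pdiv (P.eta n) (1 : B7Prop1Explicit.Site P.d → Fin P.d → (MatA N)ˣ)
              (plaqCovDeriv (P.eta n) (1 : B7Prop1Explicit.Site P.d → Fin P.d → (MatA N)ˣ)
                (c.expo (P.eta n) (fun x μ => ιSU N (U ⟨cover P (x + t), μ⟩)) um)) μ x) ≤ r ∧
        bondNorm P.L c.k (P.eta n) (-(3 : ℝ)) c.sq
            (fun x μ => covLap (P.eta n) (1 : B7Prop1Explicit.Site P.d → Fin P.d → (MatA N)ˣ)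
              (fun z => c.expo (P.eta n) (fun x μ => ιSU N (U ⟨cover P (x + t), μ⟩)) um z μ) x) ≤ r)
    {X Xt X' : Set (Pt P.d)} (hXX' : X ⊆ X') (hXt : Xt ⊆ X) (hsq0X' : c.sq 0 ⊆ X') (hinj' : Set.InjOn (fun x => cover P (x + t)) X')
    (hfwd : ∀ ⦃x⦄, x ∈ X → ∀ μ, (cover P (x + t)).shift μ ∈ (fun x => cover P (x + t)) '' X → x + e μ ∈ X)
    (hfwdt : ∀ ⦃x⦄, x ∈ Xt → ∀ μ, (cover P (x + t)).shift μ ∈ (fun x => cover P (x + t)) '' Xt → x + e μ ∈ Xt)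
    (hbwdt : ∀ ⦃x⦄, x ∈ Xt → ∀ ν, (cover P (x + t)).unshift ν ∈ (fun x => cover P (x + t)) '' Xt → x - e ν ∈ Xt)
    (hsq : X ⊆ c.sq 0) (hbox : Xt ⊆ cubeZ P.L c.a c.M c.ρ c.k c.k)
    (h4 : 4 * ((N : ℝ) * r) < 2 * Real.pi) :
    letI : CStarAlgebra (MatA N) := {}
    ∃ u : GaugeTransf P 0 (SU N), ∃ A : PBond P 0 → MatA N,
      (∀ b ∈ (Sect2.regionOfSet P ((fun x => cover P (x + t)) '' X)).bonds, gaugeU (fun x => ιSU N (u x)) (fun b' => ιSU N (U b')) b = expI (P.eta n) (A b)) ∧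
      (∀ j, j ≤ c.k → ∀ (x : Pt P.d) (μ : Fin P.d), x ∈ X → x + e μ ∈ X → x ∈ c.sq j → x + e μ ∈ c.sq j →
          ‖A ⟨cover P (x + t), μ⟩‖ ≤ 2 * (r * ((P.L : ℝ) ^ j * P.eta n)⁻¹)) ∧
      (∀ b ∈ (Sect2.regionOfSet P ((fun x => cover P (x + t)) '' Xt)).bonds, ‖A b‖ ≤ 2 * (r * P.L)) ∧
      (∀ q ∈ (Sect2.regionOfSet P ((fun x => cover P (x + t)) '' Xt)).dpairs, ‖grad (P.eta n) q.2.1 (fun y => A ⟨y, q.2.2⟩) q.1‖ ≤ 2 * (r * (P.L : ℝ) ^ 2)) ∧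
      (∀ b ∈ Sect2.bondsDeep ((fun x => cover P (x + t)) '' Xt), ‖Sect2.codiffCurlA (P.eta n) A b.src b.dir‖ ≤ 2 * (r * (P.L : ℝ) ^ 3)) ∧
      (∀ b ∈ Sect2.bondsDeep ((fun x => cover P (x + t)) '' Xt),
          ‖∑ ν : Fin P.d, ((P.eta n : ℝ) : ℂ)⁻¹ •
              (grad (P.eta n) ν (fun y => A ⟨y, b.dir⟩) (b.src.unshift ν) - grad (P.eta n) ν (fun y => A ⟨y, b.dir⟩) b.src)‖ ≤ 2 * (r * (P.L : ℝ) ^ 3)) ∧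
      (∀ x, x ∈ X' → ∀ μ, A ⟨cover P (x + t), μ⟩ = logCfg (P.eta n) (c.fixed (fun x μ => ιSU N (U ⟨cover P (x + t), μ⟩)) um) x μ) ∧
      IsLandau138Z P.L c.k (P.eta n) (c.sq 0) c.lamS (1 : B7Prop1Explicit.Site P.d → Fin P.d → (MatA N)ˣ)
        (logCfg (P.eta n) (c.fixed (fun x μ => ιSU N (U ⟨cover P (x + t), μ⟩)) um)) ∧
      (∀ x, x ∈ c.sq 0 → ιSU N (u (cover P (x + t))) = (um x)⁻¹ * c.vfix (fun x μ => ιSU N (U ⟨cover P (x + t), μ⟩)) x) ∧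
      (∀ x, um x ∈ specialUnitaryUnits (Fin N)) ∧ (∀ x, x ∉ c.sq 0 → um x = 1) ∧
      -- ★ NEW (T2b input, ℤᵈ side, passed through): (152) member 2 at EVERY level for the exported `um`
      (∀ j, j ≤ c.k → ∀ (x : B7Prop1Explicit.Site P.d) (μ ν : Fin P.d), x ∈ c.sq j → x + e μ ∈ c.sq j →
          ‖logCfg (P.eta n) (c.fixed (fun x μ => ιSU N (U ⟨cover P (x + t), μ⟩)) um) (x + e μ) ν
              - logCfg (P.eta n) (c.fixed (fun x μ => ιSU N (U ⟨cover P (x + t), μ⟩)) um) x ν‖ ≤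
            2 * (P.eta n * r * (((P.L : ℝ) ^ j * P.eta n) ^ 2)⁻¹)) ∧
      -- ★ NEW (pass-through): the crown's `(−2)` row for `um`
      msup P.L c.k (P.eta n) (-(2 : ℝ)) (fun j (q : Fin P.d × Fin P.d × B7Prop1Explicit.Site P.d) => SideTouches (c.sq j) q.2.2 q.2.1)
          (fun q => covDerivFwd (P.eta n) (1 : B7Prop1Explicit.Site P.d → Fin P.d → (MatA N)ˣ) q.1
            (fun z => c.expo (P.eta n) (fun x μ => ιSU N (U ⟨cover P (x + t), μ⟩)) um z q.2.1) q.2.2) ≤ r := by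
  classical
  letI : CStarAlgebra (MatA N) := {}
  have hLo : Odd P.L := P.hL.1
  have hL : 2 ≤ P.L := P.hL.2
  have hηpos : 0 < P.eta n := B3GkZeroTorusRescaled.eta_pos P n
  set V : B7Prop1Explicit.Site P.d → Fin P.d → (MatA N)ˣ := fun x μ => ιSU N (U ⟨cover P (x + t), μ⟩) with hV
  have hVsu : ∀ x μ, V x μ ∈ specialUnitaryUnits (Fin N) := fun x μ => by
    rw [hV]; exact mem_specialUnitaryUnits.2 (U ⟨cover P (x + t), μ⟩).2
  obtain ⟨s, h1, hlev, h2, h3, h4c, h4', h5, hsid, hsu, hoff, hgradAll, hmsup⟩ :=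
    exists_suGauge_letters152_recTower_member_grad_precomp_explicit hd hLo hL c V hVsu hηpos hr um hG h4
  -- the scale of the dent's level: `L^{k−1}·η_n = L⁻¹`, `Lᵏ·η_n = 1`
  have hscale : (P.L : ℝ) ^ c.k * P.eta n = 1 := by rw [hk]; exact B12Eq115BackgroundPair.pow_mul_eta P n
  have hLpos : (0 : ℝ) < P.L := by exact_mod_cast P.L_pos
  have hscale' : (P.L : ℝ) ^ (c.k - 1) * P.eta n = (P.L : ℝ)⁻¹ := by
    have hk1 : c.k - 1 + 1 = c.k := Nat.sub_add_cancel c.one_le_k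
    have h : (P.L : ℝ) ^ c.k = (P.L : ℝ) ^ (c.k - 1) * P.L := by rw [← pow_succ, hk1]
    have h' : (P.L : ℝ) ^ (c.k - 1) * P.eta n * P.L = 1 := by rw [mul_right_comm, ← h, hscale]
    exact eq_inv_of_mul_eq_one_left h'
  simp only [hscale', inv_inv, inv_pow] at h2 h3 h4c h4'
  set A' : B7Prop1Explicit.Site P.d → Fin P.d → MatA N := logCfg (P.eta n) (c.fixed V um) with hA'
  have hinjt : Set.InjOn (fun x => cover P (x + t)) Xt := hinj'.mono (hXt.trans hXX')
  -- push-down through the translated cover, injective on the LARGE window `X′`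
  let u : GaugeTransf P 0 (SU N) := fun y =>
    if h : ∃ x, x ∈ X' ∧ cover P (x + t) = y then s (Classical.choose h) else 1
  let A : PBond P 0 → MatA N := fun b =>
    if h : ∃ x, x ∈ X' ∧ cover P (x + t) = b.src then A' (Classical.choose h) b.dir else 0
  have hu : ∀ x, x ∈ X' → u (cover P (x + t)) = s x := by
    intro x hx
    have hex : ∃ x', x' ∈ X' ∧ cover P (x' + t) = cover P (x + t) := ⟨x, hx, rfl⟩
    simp only [u, dif_pos hex]
    rw [hinj' (Classical.choose_spec hex).1 hx (Classical.choose_spec hex).2]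
  have hA : ∀ x, x ∈ X' → ∀ μ, A ⟨cover P (x + t), μ⟩ = A' x μ := by
    intro x hx μ
    have hex : ∃ x', x' ∈ X' ∧ cover P (x' + t) = cover P (x + t) := ⟨x, hx, rfl⟩
    simp only [A, dif_pos hex]
    rw [hinj' (Classical.choose_spec hex).1 hx (Classical.choose_spec hex).2]
  have hlift : ∀ y, y ∈ (fun x => cover P (x + t)) '' X → ∃ x, x ∈ X ∧ cover P (x + t) = y := fun y ⟨x, hx, hxy⟩ => ⟨x, hx, hxy⟩
  have hliftt : ∀ y, y ∈ (fun x => cover P (x + t)) '' Xt → ∃ x, x ∈ Xt ∧ cover P (x + t) = y := fun y ⟨x, hx, hxy⟩ => ⟨x, hx, hxy⟩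
  have hXtX' : Xt ⊆ X' := hXt.trans hXX'
  have hL1 : (1 : ℝ) ≤ P.L := by exact_mod_cast P.L_pos
  refine ⟨u, A, fun b hb => ?_, fun j hj x μ hx hx' hxj hxj' => ?_, fun b hb => ?_, fun q hq => ?_, fun b hb => ?_, fun b hb => ?_, hA, h5,
    fun x hx => ?_, hsu, hoff, hgradAll, hmsup⟩
  · obtain ⟨x, hx, hxs⟩ := hlift b.src hb.1
    have hx' : x + e b.dir ∈ X := hfwd hx b.dir (by rw [hxs]; exact hb.2)
    have hb' : b = ⟨cover P (x + t), b.dir⟩ := by cases b; simp only at hxs; rw [hxs]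
    rw [hb', hA x (hXX' hx)]
    have hgauge := h1 x b.dir (hsq hx) (hsq hx')
    rw [cfgExp_eq_expI] at hgauge
    rw [← hgauge]
    simp only [gaugeU, B7Prop1Explicit.gaugeAct, PBond.tgt, ← cover_shift_add_e, hu x (hXX' hx), hu (x + e b.dir) (hXX' hx'), hV]
  · rw [hA x (hXX' hx)]
    exact hlev j hj x μ hxj hxj'
  · obtain ⟨x, hx, hxs⟩ := hliftt b.src hb.1
    have hx' : x + e b.dir ∈ Xt := hfwdt hx b.dir (by rw [hxs]; exact hb.2)
    have hb' : b = ⟨cover P (x + t), b.dir⟩ := by cases b; simp only at hxs; rw [hxs]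
    rw [hb', hA x (hXtX' hx)]
    exact h2 x b.dir (hbox hx) (hbox hx')
  · obtain ⟨hq1, hq2, hq3, -⟩ := hq
    obtain ⟨x, hx, hxs⟩ := hliftt q.1 hq1
    have hxμ : x + e q.2.1 ∈ Xt := hfwdt hx q.2.1 (by rw [hxs]; exact hq2)
    have hxν : x + e q.2.2 ∈ Xt := hfwdt hx q.2.2 (by rw [hxs]; exact hq3)
    rw [grad, ← hxs, ← cover_shift_add_e, hA x (hXtX' hx), hA (x + e q.2.1) (hXtX' hxμ), norm_smul, norm_inv, Complex.norm_real, Real.norm_eq_abs,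
      abs_of_pos hηpos]
    calc (P.eta n)⁻¹ * ‖A' (x + e q.2.1) q.2.2 - A' x q.2.2‖ ≤ (P.eta n)⁻¹ * (2 * (P.eta n * r * (P.L : ℝ) ^ 2)) :=
          mul_le_mul_of_nonneg_left (h3 x q.2.1 q.2.2 (hbox hx) (hbox hxμ) (hbox hxν)) (inv_nonneg.2 hηpos.le)
      _ = 2 * (r * (P.L : ℝ) ^ 2) := by field_simp
  · obtain ⟨hb1, hb2, hbν⟩ := hb
    obtain ⟨x, hx, hxs⟩ := hliftt b.src hb1
    have hxμ : x + e b.dir ∈ Xt := hfwdt hx b.dir (by rw [hxs]; exact hb2)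
    have hstencil : ∀ ν, x + e ν ∈ Xt ∧ x - e ν ∈ Xt ∧ x - e ν + e b.dir ∈ Xt := by
      intro ν
      obtain ⟨s1, s2, s3, s4⟩ := hbν ν
      have hxν : x + e ν ∈ Xt := hfwdt hx ν (by rw [hxs]; exact s1)
      have hxν' : x - e ν ∈ Xt := hbwdt hx ν (by rw [hxs]; exact s2)
      have hxν'' : x - e ν + e b.dir ∈ Xt :=
        hfwdt hxν' b.dir (by
          rw [cover_shift_sub_e, hxs, ← Site.unshift_shift_comm]
          exact s4)
      exact ⟨hxν, hxν', hxν''⟩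
    have hb' : b = ⟨cover P (x + t), b.dir⟩ := by cases b; simp only at hxs; rw [hxs]
    rw [hb']
    show ‖Sect2.codiffCurlA (P.eta n) A (cover P (x + t)) b.dir‖ ≤ 2 * (r * (P.L : ℝ) ^ 3)
    have hAX : ∀ z, z ∈ Xt → ∀ κ, A ⟨cover P (z + t), κ⟩ = A' z κ := fun z hz => hA z (hXtX' hz)
    rw [codiffCurlA_coverShift_eq_pdiv_of_window (P.eta n) t hAX hx hxμ hstencil]
    exact h4c x b.dir (hbox hx) (hbox hxμ) fun ν => ⟨hbox (hstencil ν).1, hbox (hstencil ν).2.1, hbox (hstencil ν).2.2⟩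
  · obtain ⟨hb1, hb2, hbν⟩ := hb
    obtain ⟨x, hx, hxs⟩ := hliftt b.src hb1
    have hxμ : x + e b.dir ∈ Xt := hfwdt hx b.dir (by rw [hxs]; exact hb2)
    have hstencil : ∀ ν, x + e ν ∈ Xt ∧ x - e ν ∈ Xt := by
      intro ν
      obtain ⟨s1, s2, -, -⟩ := hbν ν
      exact ⟨hfwdt hx ν (by rw [hxs]; exact s1), hbwdt hx ν (by rw [hxs]; exact s2)⟩
    have hb' : b = ⟨cover P (x + t), b.dir⟩ := by cases b; simp only at hxs; rw [hxs]
    rw [hb']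
    show ‖∑ ν : Fin P.d, ((P.eta n : ℝ) : ℂ)⁻¹ •
        (grad (P.eta n) ν (fun y => A ⟨y, b.dir⟩) ((cover P (x + t)).unshift ν) - grad (P.eta n) ν (fun y => A ⟨y, b.dir⟩) (cover P (x + t)))‖ ≤
          2 * (r * (P.L : ℝ) ^ 3)
    have hAX : ∀ z, z ∈ Xt → ∀ κ, A ⟨cover P (z + t), κ⟩ = A' z κ := fun z hz => hA z (hXtX' hz)
    rw [lap_coverShift_eq_covLap_of_window (P.eta n) t hAX hx hstencil]
    exact h4' x b.dir (hbox hx) (hbox hxμ) fun ν => ⟨hbox (hstencil ν).1, hbox (hstencil ν).2⟩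
  · rw [hu x (hsq0X' hx)]
    exact hsid x hx

end Stage2PrecompExplicit

end Literature.MathematicalPhysics.QuantumFieldTheory.Balaban1983to89.Node00

end
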